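import Summits.BirchSwinnertonDyer.BirchSwinnertonDyer.Theorems.PrintCf2RubinValueTwoFrameSeed
import Summits.BirchSwinnertonDyer.BirchSwinnertonDyer.Theorems.PrintCf2RubinValueTwoRubinValueFormulaAtTwoOfKatzValue
import HarnessLib

/-!
# U_S2′ UNCONDITIONAL: the two-variable Katz measure of the `θK⁻¹`-frame is UNIQUE on every S2′ frame at `p = 2`, and the v10
# Rubin value formula (aside 23721) follows from its research kernel R in existence form ALONE
# (crux `stmt-BirchSwinnertonDyer-23721` `PrintCf2RubinValueTwo.RubinValueFormulaAtTwo`, line `value-transport` — closing corollaries)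

Cell `bsd-print-cf2`, seat `cruxlead-23721` g3.  `--supports` the item; no definitions.  With B18 (-w5 g4 p680279,
`Bricks.stub_isKatzMeasure₂_unique_two`), B18t (g0 p683009, `KatzUniqueTransport.isKatzMeasure₂_unique_of_seed`) and B18s (this seat,
`FrameSeed.frameSeed_two`) all in the tree, the kernel theorems of g0's `RubinValueFormulaKernel` (p683956) lose their `hSeed` hypothesis:

* **`frameUnique_two`** — on every S2′ frame (member of the cm7 twist class, `K` pinned by `L(ψ,s) = L(W,s)`, `2 = v v̄`, `ι` pinned
  to `v`, any generator pair of the `ℤ₂²`-tower, `θK` quadratic with exact ramification `Sθ`), two solutions `G, G'` of de Shalit's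
  frame `IsKatzMeasure₂ ι v v̄ Sθ κ₁ κ₂ γ₁⁻¹ γ₂⁻¹ θK⁻¹ Ω δ Ωp` COINCIDE — de Shalit II.4.17 uniqueness at the additive split prime 2,
  UNCONDITIONAL;
* **`rubinValueFormulaAtTwo_of_katzValue`** — the v10 item `RubinValueFormulaAtTwo` (stmt-23721, now an aside of route C) follows
  BY NAME from the research kernel R (`stub_katzRubinValue_two`, existence form) ALONE.

HONEST FRAMING: corollaries by composition; R stays open (research, beyond print at 2); the live crux 24034 (v11) is not touched.
beyond-print theorem: no.  BSD is not proved by any of this.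

References: [deShalit1987] II.4.16 (49)–(50), II.4.17 (52)–(54); [Rubin1992] Cor. 10.3 (shape); [GrossZagier1986] Thm. I.(7.3).
-/

-- the summit namespace `Summit.BirchSwinnertonDyer.BirchSwinnertonDyer` repeats the problem name by design (D-0017)
set_option linter.dupNamespace false
set_option autoImplicit false

noncomputable section

open scoped Classical

open NumberField IsDedekindDomain Field WeierstrassCurve Literature.NumberTheory.GaloisRepresentations
  Literature.NumberTheory.EllipticCurves Literature.NumberTheory.EllipticCurves.Rank1Residual
  Literature.NumberTheory.EllipticCurves.DeShalit1987

namespace Summit.BirchSwinnertonDyer.BirchSwinnertonDyer.Theorems.PrintCf2.FrameSeed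

/-- **U_S2′ — KATZ-FRAME UNIQUENESS ON EVERY S2′ FRAME AT `p = 2`, UNCONDITIONAL**: two solutions of de Shalit's two-variable frame for
`θK⁻¹` at the inverse generators of any generator pair of the `ℤ₂²`-tower coincide (B18 ∧ B18t ∧ B18s, all tree theorems).
[cite: deShalit1987, II.4.16 (49)–(50), II.4.17 (52)–(54)] -/
theorem frameUnique_two :
    ∀ (d : ℤ), d ≠ 0 → Squarefree d → d % 4 ≠ 1 →
    ∀ (W : WeierstrassCurve ℚ) [W.IsElliptic] [W.IsGloballyMinimal] (C : VariableChange ℚ),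
    C • W = cm7.quadraticTwist (d : ℚ) → W.analyticRank = 1 →
    ∀ (K : Type) [Field K] [NumberField K], IsImaginaryQuadratic K →
    ∀ (v vbar : HeightOneSpectrum (𝓞 K)),
    ((2 : ℕ) : 𝓞 K) ∈ v.asIdeal → ((2 : ℕ) : 𝓞 K) ∈ vbar.asIdeal → vbar ≠ v →
    ∀ (ι : PadicAlgCl 2 ≃+* ℂ),
    (∀ (w : InfinitePlace K) (k : 𝓞 K), k ∈ v.asIdeal ↔ ‖ι.symm (w.embedding (k : K))‖ < 1) →
    ∀ (c : K ≃ₐ[ℚ] K), c ≠ 1 →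
    ∀ (ψ : HeckeCharacter K), ψ.HasInfinityType (fun _ ↦ 1) (fun _ ↦ 0) →
    (∀ s : ℂ, 3 / 2 < s.re → heckeLFunction ψ s = W.LSeries s) →
    ∀ (κ₁ κ₂ : ZpExtension K 2) (γ₁ γ₂ : absoluteGaloisGroup K), ZpExtension.IsTopGeneratorPair κ₁ κ₂ γ₁ γ₂ →
    ∀ (θK ρ : HeckeCharacter K) (r : FramedGaloisRep K (PadicAlgCl 2) 1),
    θK * θK = 1 → IsPAdicAvatarOf ι ρ r → FactorsThroughPair κ₁ κ₂ r →
    θK⁻¹ * ρ = (HeckeCharacter.galConj c ψ)⁻¹ →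
    ∀ (Sθ : Finset (HeightOneSpectrum (𝓞 K))), v ∉ Sθ → vbar ∉ Sθ →
    (∀ w ∈ Sθ, ¬ θK.IsUnramifiedAt w) →
    (∀ w : HeightOneSpectrum (𝓞 K), w ∉ Sθ → w ≠ v → w ≠ vbar → θK.IsUnramifiedAt w) →
    ∀ (Ω δ : ℂ) (Ωp : ℂ_[2]) (G G' : PowerSeries (PowerSeries (PadicComplexInt 2))),
    IsKatzMeasure₂ ι v vbar Sθ κ₁ κ₂ γ₁⁻¹ γ₂⁻¹ θK⁻¹ Ω δ Ωp G →
    IsKatzMeasure₂ ι v vbar Sθ κ₁ κ₂ γ₁⁻¹ γ₂⁻¹ θK⁻¹ Ω δ Ωp G' → G = G' :=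
  RubinValueFormulaKernel.frameUnique_two_of_seed frameSeed_two

/-- **The v10 Rubin value formula (aside 23721) from its research kernel R in existence form alone**: if on every S2′ frame, for
`q = #Ш_an`, SOME solution of the frame takes a value of the Rubin norm at the point, then `RubinValueFormulaAtTwo` holds BY NAME
(uniqueness `frameUnique_two` identifies the frame's `G₂` with the witness).  CONDITIONAL on the displayed `hR` (= registered stub
`stub_katzRubinValue_two` of line `value-transport`; research, beyond print at 2). [cite: Rubin1992, Cor. 10.3 (shape)]
[cite: GrossZagier1986, Thm. I.(7.3) 2)] -/
theorem rubinValueFormulaAtTwo_of_katzValue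
    (hR :
      GrossZagier1986_thm_I_7_3 → rank_eq_analyticRank_of_analyticRank_le_one →
      ∃ eA : ℤ → ℤ → ℤ,
      ∀ (d : ℤ), d ≠ 0 → Squarefree d → d % 4 ≠ 1 →
      ∀ (W : WeierstrassCurve ℚ) [W.IsElliptic] [W.IsGloballyMinimal] (C : VariableChange ℚ),
      C • W = cm7.quadraticTwist (d : ℚ) → W.analyticRank = 1 →
      ∀ (K : Type) [Field K] [NumberField K], IsImaginaryQuadratic K →
      ∀ (v vbar : HeightOneSpectrum (𝓞 K)),
      ((2 : ℕ) : 𝓞 K) ∈ v.asIdeal → ((2 : ℕ) : 𝓞 K) ∈ vbar.asIdeal → vbar ≠ v →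
      ∀ (ι : PadicAlgCl 2 ≃+* ℂ),
      (∀ (w : InfinitePlace K) (k : 𝓞 K), k ∈ v.asIdeal ↔ ‖ι.symm (w.embedding (k : K))‖ < 1) →
      ∀ (c : K ≃ₐ[ℚ] K), c ≠ 1 →
      ∀ (ψ : HeckeCharacter K), ψ.HasInfinityType (fun _ ↦ 1) (fun _ ↦ 0) →
      (∀ s : ℂ, 3 / 2 < s.re → heckeLFunction ψ s = W.LSeries s) →
      ∀ (κ₁ κ₂ : ZpExtension K 2) (γ₁ γ₂ : absoluteGaloisGroup K), ZpExtension.IsTopGeneratorPair κ₁ κ₂ γ₁ γ₂ →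
      ∀ (θK ρ : HeckeCharacter K) (r : FramedGaloisRep K (PadicAlgCl 2) 1),
      θK * θK = 1 → IsPAdicAvatarOf ι ρ r → FactorsThroughPair κ₁ κ₂ r →
      θK⁻¹ * ρ = (HeckeCharacter.galConj c ψ)⁻¹ →
      ∀ (Sθ : Finset (HeightOneSpectrum (𝓞 K))), v ∉ Sθ → vbar ∉ Sθ →
      (∀ w ∈ Sθ, ¬ θK.IsUnramifiedAt w) →
      (∀ w : HeightOneSpectrum (𝓞 K), w ∉ Sθ → w ≠ v → w ≠ vbar → θK.IsUnramifiedAt w) →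
      ∀ (Ω δ : ℂ) (Ωp : (unrIntegers 2)ˣ) (G₂ : PowerSeries (PowerSeries (PadicComplexInt 2))),
      Ω ≠ 0 → (δ ^ 2 = (NumberField.discr K : ℂ) ∨ δ ^ 2 = -(NumberField.discr K : ℂ)) →
      IsKatzMeasure₂ ι v vbar Sθ κ₁ κ₂ γ₁⁻¹ γ₂⁻¹ θK⁻¹ Ω δ ((Ωp : unrIntegers 2) : ℂ_[2]) G₂ →
      ∀ (P : W.toAffine.Point) (c₀ : ℕ) (ℓ : ℤ),
      ¬ IsOfFinAddOrder P →
      (∀ R : W.toAffine.Point, ∃ (k : ℤ) (T : W.toAffine.Point), IsOfFinAddOrder T ∧ R = k • P + T) →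
      c₀ ≠ 0 → (W.baseChange ℚ_[2]).IsInReductionKernel (c₀ • W.toPadicPoint 2 P) →
      ‖(W.baseChange ℚ_[2]).padicLogPoint (c₀ • W.toPadicPoint 2 P) / (c₀ : ℚ_[2])‖ = (2 : ℝ) ^ (-ℓ) →
      ∀ (q : ℚ), shaAn W = (q : ℂ) →
      ∃ G₀ : PowerSeries (PowerSeries (PadicComplexInt 2)),
      IsKatzMeasure₂ ι v vbar Sθ κ₁ κ₂ γ₁⁻¹ γ₂⁻¹ θK⁻¹ Ω δ ((Ωp : unrIntegers 2) : ℂ_[2]) G₀ ∧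
      ∃ val₀ : ℂ_[2],
      IntSeries.HasValueAt₂ G₀ (avatarValueAt r γ₁⁻¹ - 1) (avatarValueAt r γ₂⁻¹ - 1) val₀ ∧
      ‖val₀‖ = (2 : ℝ) ^ (-((2 * (padicValRat 2 q + (padicValNat 2 W.tamagawaProduct : ℤ)
      - 2 * (padicValNat 2 W.torsionOrder : ℤ) + 2 * ℓ) + eA (d % 2) ((d / (2 - d % 2)) % 8) : ℤ) : ℝ) / 2)) :
    Summit.BirchSwinnertonDyer.BirchSwinnertonDyer.Theses.PrintCf2RubinValueTwo.RubinValueFormulaAtTwo :=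
  RubinValueFormulaKernel.rubinValueFormulaAtTwo_of_seed_of_katzValue frameSeed_two hR

end Summit.BirchSwinnertonDyer.BirchSwinnertonDyer.Theorems.PrintCf2.FrameSeed

end
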